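import Summits.ResolutionOfSingularities.ResolutionOfSingularities.Theorems.EquisingularLiftEquisingularLiftNatTowerBPairRoundOfFact
import Summits.ResolutionOfSingularities.ResolutionOfSingularities.Theorems.EquisingularLiftEquisingularLiftNatBoundaryWitnessedCentre
import Summits.ResolutionOfSingularities.ResolutionOfSingularities.Theorems.EquisingularLiftEquisingularLiftNatTowerRoundBDoublePrimeDefs
import Summits.ResolutionOfSingularities.ResolutionOfSingularities.Theorems.EquisingularLiftEquisingularLiftNatTowerBPrimeAssembly
import HarnessLib

/-!
# [OURS · L1 W4.5(b) · EL♮(3) · T23-A″] THE ROUND CLOSURE OF `TowerRoundBDoublePrime` ON `Tower.InvB` AT THE DATUM «`V(𝓔)` IS `O`-FLAT»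
# — all THREE host branches (running surface / retained member / NEW: PAIR), every stand-in discharged; shared by V10″ and the nose engine″

res-L1-w45b-stub-4 g11 (T23-A / A′ / A″ engine owner; engine word `L/res-L1-w45b-stub-4/T23Adprime-ENGINE-WORD.md` 16d03a46d50c8ccd §2–§4, desk R20).
Crux EL♮(3) = stmt-ResolutionOfSingularities-20148 (parent stmt-…-20038); rung targets″ `stub_elnat_defTowerBDoublePrimePointResolutionThree` /
`stub_elnat_defNoseTowerBDoublePrimeResolutionThree` (lead-2's …NatTowerRoundBDoublePrimeDefs, 30th registration). OURS; NOT a statement of any manuscript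
([Hironaka2017] is a candidate under adjudication, nothing of it is asserted); AI-written, weaker than expert review. DEF-FREE; no `sorry`; standard axioms.
`--supports stmt-ResolutionOfSingularities-20148 --as helper`.

WHAT. `Tower.towerRoundBDoublePrime_invB_of_fact hFact : TowerRoundBDoublePrime F₉ F₁₀ υ' Z₉ hZ₉ (INV₁ F₉ Z₉ hZ₉ F₁₀ υ')` for the engine's invariant
`INV₁ := (Tower.InvB FE … ∧ K-side facts) ∧ hcar` (the nose engine's shape; `Tower.towerRoundBDoublePrime_invB_of_fact'` = the same for V10's shape with the extra
conjunct `IsLocallyNoetherian F₉`). Branches 1–2 = the `hround` block of …NatTowerBPrimeAssembly / …NatNoseTowerBPrimeOfFact VERBATIM (res-L1-w45b-stub-2's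
`Tower.invB_embRound_of_fact_anyPrime` / `Tower.invB_coneRound_of_anyPrime`; the extra alternative `F = W = Hst` of `RoundTransportOKDoublePrime` folds into `F = Hst`).
Branch 3 (PAIR, engine word §2 calling convention) = `Tower.invB_pairRound_of_fact` (p616482) with res-L1-w45b-stub-2's (A″-1)/(A″-2) v2
`isRegular_subscheme_sup_of_trace_crossing` / `flat_subschemeι_sup_of_trace_crossing` (p616010) BY NAME as `hA1`/`hA2`: case A `Hst = E` (host := the running
surface with its shadow `K`); case B `W = E` (roles swapped: `ConeWitness` is symmetric for closed sets — `Set.inter_comm`, `sup_comm`); case C (host `Hst ∈ Es`,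
`KH := ∅`, the running surface a plain candidate, the shadow kept only under `Disjoint Z (closure K)` via `Tower.invB_shadow_of_disjoint`, as B′ branch 2).
[cite: GortzWedhorn2020, (13.19) and Prop. 13.91] [cite: Matsumura1987, Thm. 15.1]
-/

set_option linter.dupNamespace false -- mandated namespace `Summit.<Summit>.<Problem>` of this single-conjunct summit
set_option linter.overlappingInstances false -- signatures carry `[IsDomain O] [IsDiscreteValuationRing O]`

noncomputable section

open CategoryTheory CategoryTheory.Limits AlgebraicGeometry TopologicalSpace Topology IsLocalRing
open Literature.AlgebraicGeometry.Resolution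
open AlgebraicGeometry.Scheme.IdealSheafData
open Summit.ResolutionOfSingularities.ResolutionOfSingularities.Theses.EquisingularLift.Split
open Summit.ResolutionOfSingularities.ResolutionOfSingularities.Cruxes.EquisingularLift.StrataSplit

namespace Summit.ResolutionOfSingularities.ResolutionOfSingularities.Cruxes.EquisingularLiftNat.Sections

section Closure

variable (O : Type) [CommRing O] [IsDomain O] [IsDiscreteValuationRing O] (k : Type) [Field k]
    (θ : O →+* k) (hθ : Function.Surjective θ)
    (P : Scheme.{0}) [IsIntegral P] (q : P ⟶ Spec (.of O)) [IsProper q] [SmoothOfRelativeDimension 3 q] (Y : Set P)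
    (hYsp : Y ⊆ q ⁻¹' {IsLocalRing.closedPoint O}) (hYirr : IsIrreducible Y) (hYcl : IsClosed Y)
    (hPnoeth : IsLocallyNoetherian P) (hPreg : Scheme.IsRegular P)
    (Ch : ∀ X' : Scheme.{0}, (X' ⟶ P) → Set X' → Prop)
    (hChStep : ∀ (X' X'' : Scheme.{0}) (σ' : X' ⟶ P) (S' : Set X') (C : X'.IdealSheafData) (τ : X'' ⟶ X'),
      Ch X' σ' S' → IsBlowup τ C → Scheme.IsRegular C.subscheme → Flat (C.subschemeι ≫ σ' ≫ q) →
      σ' '' (C.support : Set X') ⊆ {y | ¬ IsGenericPoint y Y} → (C.support : Set X') ∩ (σ' ≫ q) ⁻¹' {IsLocalRing.closedPoint O} ⊆ S' →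
      Ch X'' (τ ≫ σ') (closure (τ ⁻¹' (S' \ (C.support : Set X')))))
    (hChSplit : ∀ (X' : Scheme.{0}) (σ' : X' ⟶ P) (S' : Set X'), Ch X' σ' S' → Chain P Y X' σ' S')

include hθ hYsp hYirr hYcl hPnoeth hPreg hChStep hChSplit

set_option maxHeartbeats 800000 in
/-- **The round closure of `TowerRoundBDoublePrime` on the engine invariant** (module docstring): for every carrier `(F₉, Z₉, F₁₀, υ')` with `F₉` locally
Noetherian, the invariant `((Tower.InvB FE … G γ T E Es K ∧ IsClosed K ∧ K ⊆ closure (K ∖ E) ∧ K ≠ univ) ∧ hcar)` is closed under the B″ round step —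
branches 1–2 by the A′ rounds of fact, branch 3 (PAIR) by `Tower.invB_pairRound_of_fact` over res-L1-w45b-stub-2's (A″-1)/(A″-2) v2. [OURS · L1 W4.5b · T23-A″ engine]
toward `stub_elnat_def{Tower,NoseTower}BDoublePrime…Three`; NOT a statement of the manuscript. -/
theorem Tower.towerRoundBDoublePrime_invB_of_fact (hFact : EmbeddedCurveLift O k θ P q) :
    ∀ {F₉ : Scheme.{0}} (Z₉ : Set F₉) (hZ₉ : IsClosed Z₉) {F₁₀ : Scheme.{0}} (υ' : F₁₀ ⟶ F₉), IsLocallyNoetherian F₉ →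
      TowerRoundBDoublePrime F₉ F₁₀ υ' Z₉ hZ₉ (fun G γ T E Es K =>
        (Tower.InvB O k θ P q Y Ch (fun _ _ _ _ _ _ _ _ _ σ _ 𝓔 => Flat (𝓔.subschemeι ≫ σ ≫ q)) F₉ Z₉ hZ₉ F₁₀ υ' G γ T E Es K ∧
          IsClosed K ∧ K ⊆ closure (K \ E) ∧ K ≠ Set.univ) ∧
        (∀ z : ↥(redSub F₉ Z₉ hZ₉), IsClosed ({z} : Set ↥(redSub F₉ Z₉ hZ₉)) →
          ringKrullDim ((redSub F₉ Z₉ hZ₉).presheaf.stalk z) = ((1 : ℕ) : WithBot ℕ∞))) := by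
  intro F₉ Z₉ hZ₉ F₁₀ υ' hF₉noeth G G' γ T E Es K hE Z hZ Hst W υ₂ K' E' Es' hinv hZT hZne hfull hadm hυ₂ hEs'
  haveI := hF₉noeth
  -- the three rounds of fact at `FE`
  have hEmbB := Tower.invB_embRound_of_fact_anyPrime O k θ hθ P q Y hYsp hYirr hYcl hPnoeth hPreg Ch hChStep hChSplit hFact Z₉ hZ₉ υ'
  have hConeB := Tower.invB_coneRound_of_anyPrime O k θ hθ P q Y hYirr hYcl hPnoeth hPreg Ch hChStep hChSplit Z₉ hZ₉ υ'
  have hPairB := Tower.invB_pairRound_of_fact O k θ hθ P q Y hYirr hYcl hPnoeth hPreg Ch hChStep hChSplit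
    (fun {_ _} _ {_ _ _ _ _ _ _ _ _} hXreg hsq hθ' hprop hE1 hE2 hF1 hF2 hW1 hW2 hWdim => by
      haveI := hprop
      exact isRegular_subscheme_sup_of_trace_crossing hXreg hsq hθ' hE1 hE2 hF1 hF2 hW1 hW2 hWdim)
    (fun {_ _} _ {_ _ _ _ _ _ _ _ _} hXreg hsq hθ' hprop hE1 hE2 hF1 hF2 hW1 hW2 hWdim => by
      haveI := hprop
      exact flat_subschemeι_sup_of_trace_crossing hXreg hsq hθ' hE1 hE2 hF1 hF2 hW1 hW2 hWdim)
    Z₉ hZ₉ υ'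
  obtain ⟨hI, hcar⟩ := hinv
  have hGint : IsIntegral G := hI.1.2.2.1
  haveI := hGint
  haveI : IsLocallyNoetherian G := by
    obtain ⟨-, -, -, -, -, -, -, -, X, σ, S, jG, tG, -, -, hXnoeth, -, -, hsq, -, -⟩ := hI.1
    haveI := hXnoeth
    haveI : IsClosedImmersion (Spec.map (CommRingCat.ofHom θ)) := IsClosedImmersion.spec_of_surjective _ hθ
    haveI : IsClosedImmersion jG := MorphismProperty.IsStableUnderBaseChange.of_isPullback hsq.flip inferInstance
    exact LocallyOfFiniteType.isLocallyNoetherian jG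
  have hZsupp : ((vanishingIdeal (⟨Z, hZ⟩ : Closeds G) : G.IdealSheafData).support : Set G) = Z :=
    Scheme.IdealSheafData.coe_support_vanishingIdeal _
  rcases hadm with ⟨hWH, hHst, hZE, hadm, hE', hK'⟩ | ⟨hWH, hHmem, hF, hZH, hirr, hZreg, hGreg, hHZreg, hunobs, hE', hK'⟩ |
      ⟨hHmem, hWmem, hHW, hH, hW, hpair, hZreg, hE', hK'⟩
  · -- branch 1: host = the running surface `E` (shadow `K`); `W = Hst`
    subst hHst
    subst hWH
    have hEs'1 : ∀ F' ∈ Es', ∃ F ∈ W :: Es, RoundTransportOKPrime υ₂ Z hZ W F F' := fun F' hF' => by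
      obtain ⟨F, hF, h1, h2⟩ := hEs' F' hF'
      refine ⟨F, hF, ?_, h2⟩
      rcases h1 with h | h | h | h
      · exact Or.inl h
      · exact Or.inl h
      · exact Or.inr (Or.inl h)
      · exact Or.inr (Or.inr h)
    have hZET : Z ⊆ W ∩ T := fun z hz => ⟨hZE hz, hZT hz⟩
    rcases hadm with ⟨hsec, hcech | hcone⟩ | ⟨-, hZreg, -, hEZreg, hunobs⟩
    · -- a SECTION round, Čech-witnessed
      obtain ⟨hrat₉, -, hEZreg, hunobs⟩ := hcech
      have hZrat : RationalCarrier (redSub G Z hZ) := rationalCarrier_of_dirStepSec hsec hrat₉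
      have hZreg := isRegularLocalRing_stalk_of_rationalCarrier hZrat
      have hZdim := ringKrullDim_redSub_stalk_eq_of_dirStepSec hsec hcar
      rcases hK' with hK0 | ⟨hcone | hoff, hKst⟩
      · exact (fun h => ⟨h, hcar⟩) (hEmbB G G' γ T W Es K W K hE Z hZ υ₂ K' E' Es' hI (Or.inl ⟨rfl, rfl⟩) hZET hZne
          hfull hZreg hEZreg hunobs hZdim hυ₂ (Or.inl hK0) hE' hEs'1)
      · exact (fun h => ⟨h, hcar⟩) (hConeB G G' γ T W Es K hE Z hZ υ₂ K' E' Es' hI hZET hZne hfull hcone hυ₂ (Or.inr hKst) hE' hEs'1)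
      · exact (fun h => ⟨h, hcar⟩) (hEmbB G G' γ T W Es K W K hE Z hZ υ₂ K' E' Es' hI (Or.inl ⟨rfl, rfl⟩) hZET hZne
          hfull hZreg hEZreg hunobs hZdim hυ₂ (Or.inr ⟨hoff, hKst⟩) hE' hEs'1)
    · -- a SECTION round, cone-witnessed
      have hK'' : K' = ∅ ∨ K' = closure (υ₂ ⁻¹' (K \ Z)) := by
        rcases hK' with h | ⟨-, h⟩
        · exact Or.inl h
        · exact Or.inr h
      exact (fun h => ⟨h, hcar⟩) (hConeB G G' γ T W Es K hE Z hZ υ₂ K' E' Es' hI hZET hZne hfull hcone hυ₂ hK'' hE' hEs'1)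
    · -- a GENUS-FREE MULTISECTION round
      have hZdim := ringKrullDim_redSub_stalk_eq_one_of_towerFull hfull hcar
      rcases hK' with hK0 | ⟨hcone | hoff, hKst⟩
      · exact (fun h => ⟨h, hcar⟩) (hEmbB G G' γ T W Es K W K hE Z hZ υ₂ K' E' Es' hI (Or.inl ⟨rfl, rfl⟩) hZET hZne
          hfull hZreg hEZreg hunobs hZdim hυ₂ (Or.inl hK0) hE' hEs'1)
      · exact (fun h => ⟨h, hcar⟩) (hConeB G G' γ T W Es K hE Z hZ υ₂ K' E' Es' hI hZET hZne hfull hcone hυ₂ (Or.inr hKst) hE' hEs'1)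
      · exact (fun h => ⟨h, hcar⟩) (hEmbB G G' γ T W Es K W K hE Z hZ υ₂ K' E' Es' hI (Or.inl ⟨rfl, rfl⟩) hZET hZne
          hfull hZreg hEZreg hunobs hZdim hυ₂ (Or.inr ⟨hoff, hKst⟩) hE' hEs'1)
  · -- branch 2: host = a RETAINED member `Hst ∈ Es` (shadow `∅`), `W = Hst`
    subst hWH
    have hEs'1 : ∀ F' ∈ Es', ∃ F ∈ E :: Es, RoundTransportOKPrime υ₂ Z hZ W F F' := fun F' hF' => by
      obtain ⟨F, hF', h1, h2⟩ := hEs' F' hF'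
      refine ⟨F, hF', ?_, h2⟩
      rcases h1 with h | h | h | h
      · exact Or.inl h
      · exact Or.inl h
      · exact Or.inr (Or.inl h)
      · exact Or.inr (Or.inr h)
    have hZHT : Z ⊆ W ∩ T := fun z hz => ⟨hZH hz, hZT hz⟩
    have hTHst : ¬ T ⊆ W := (hI.1.2.2.2.2.2.2.2.1 W hHmem).2
    have hZdim := ringKrullDim_redSub_stalk_eq_one_of_towerFull hfull hcar
    obtain ⟨hB₀, -, -, -⟩ := hEmbB G G' γ T E Es K W ∅ hF Z hZ υ₂ ∅ E' Es' hI (Or.inr ⟨hHmem, rfl⟩) hZHT hZne hfull hZreg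
      hHZreg hunobs hZdim hυ₂ (Or.inl rfl) (Or.inl hE') hEs'1
    subst hE'
    have hG'int : IsIntegral G' := hB₀.2.2.1
    haveI := hG'int
    rcases hK' with rfl | ⟨hZK, rfl⟩
    · exact ⟨⟨hB₀, isClosed_empty, Set.empty_subset _, Set.empty_ne_univ⟩, hcar⟩
    · obtain ⟨-, hKcl, -, hKne⟩ := hI
      have hTZ : ¬ T ⊆ Z := fun h => hTHst (h.trans hZH)
      have hsub : closure (υ₂ ⁻¹' (K \ Z)) ⊆ υ₂ ⁻¹' closure K :=
        closure_minimal (fun z hz => subset_closure hz.1) (isClosed_closure.preimage υ₂.continuous)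
      have hEK : Disjoint (υ₂ ⁻¹' Z) (closure (closure (υ₂ ⁻¹' (K \ Z)))) := by
        rw [closure_closure]
        refine Set.disjoint_left.mpr fun z hzZ hzK => ?_
        exact (Set.disjoint_left.mp hZK) hzZ (hsub hzK)
      refine ⟨⟨Tower.invB_shadow_of_disjoint O k θ P q Y Ch _ F₉ Z₉ hZ₉ F₁₀ υ' G' (υ₂ ≫ γ) _ _ Es' _ hB₀ hEK, isClosed_closure, ?_, ?_⟩,
        hcar⟩
      · refine closure_minimal (fun z hz => subset_closure ⟨subset_closure hz, fun hzZ => ?_⟩) isClosed_closure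
        exact (Set.disjoint_left.mp hEK) hzZ (subset_closure (subset_closure hz))
      · exact closure_preimage_ne_univ υ₂ _ hυ₂ K Z hKcl hKne hZ (fun h => hTZ (h ▸ Set.subset_univ _)) hZsupp.le _
          (Set.preimage_mono fun z hz => hz.1)
  · -- branch 3 (NEW, T23-A″): the PAIR round, centre `Z = Hst ∩ W` — engine word §2 calling convention (cases A / B / C)
    subst hE'
    have hZdim := ringKrullDim_redSub_stalk_eq_one_of_towerFull hfull hcar
    have hWc : closure W = W := hW.closure_eq
    have hHc : closure Hst = Hst := hH.closure_eq
    have hZH : Z ⊆ Hst := fun z hz => by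
      have h := hpair.1 ▸ hz
      exact h.1
    have hZW : Z ⊆ W := fun z hz => by
      have h := hpair.1 ▸ hz
      rw [hWc] at h
      exact h.2
    -- the shadow menu when the running surface takes part (cases A/B), resp. not (case C)
    have hKmenu : (Hst = E ∨ W = E) → K' = ∅ ∨ (closure (Z \ closure K) = Z ∧ K' = closure (υ₂ ⁻¹' (K \ Z))) := by
      intro hor
      rcases hK' with h | ⟨h, hKst⟩
      · exact Or.inl h
      · refine Or.inr ⟨?_, hKst⟩
        rcases h with ⟨-, h⟩ | hdisj
        · exact h
        · rw [hdisj.sdiff_eq_left, hZ.closure_eq]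
    by_cases hHE : Hst = E
    · -- case A: the running surface hosts, with its shadow
      have hEs'A : ∀ F' ∈ Es', ∃ F ∈ E :: Es,
          (F = Hst ∨ F = W ∨ Disjoint Z F ∨
            ∃ hF : IsClosed F,
              (∀ g ∈ Z ∩ F, stalkIdeal (vanishingIdeal (⟨Z, hZ⟩ : Closeds G)) g ⊔ stalkIdeal (vanishingIdeal (⟨F, hF⟩ : Closeds G)) g =
                  maximalIdeal (G.presheaf.stalk g)) ∧
                ∀ g ∈ Z ∩ F, stalkIdeal (vanishingIdeal (⟨Z, hZ⟩ : Closeds G)) g ≠ maximalIdeal (G.presheaf.stalk g)) ∧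
          F' = closure (υ₂ ⁻¹' (F \ Z)) := fun F' hF' => by
        obtain ⟨F, hF', hok⟩ := hEs' F' hF'
        exact ⟨F, hF', hok⟩
      exact (fun h => ⟨h, hcar⟩) (hPairB G G' γ T E Es K Hst K hH Z hZ W hW υ₂ K' (υ₂ ⁻¹' Z) Es' hI (Or.inl ⟨hHE, rfl⟩) hWmem hpair hZT hZne
        hfull hZreg hZdim hυ₂ (hKmenu (Or.inl hHE)) (Or.inl rfl) hEs'A)
    · by_cases hWE : W = E
      · -- case B: the running surface is the WITNESS — swap the roles (`ConeWitness` is symmetric for closed sets)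
        have hEcl' : IsClosed E := hWE ▸ hW
        obtain ⟨hZeq, hwit⟩ := hpair
        have hpair' : ConeWitness G E hEcl' Hst Z hZ := by
          refine ⟨?_, ?_⟩
          · rw [hWc, hWE] at hZeq
            rw [hHc, Set.inter_comm]; exact hZeq
          · have h1 : (⟨closure Hst, isClosed_closure⟩ : Closeds G) = ⟨Hst, hH⟩ := Closeds.ext hHc
            have h2 : (⟨closure W, isClosed_closure⟩ : Closeds G) = ⟨E, hEcl'⟩ := Closeds.ext (hWc.trans hWE)
            rw [h1, sup_comm, ← h2]; exact hwit
        have hEs'B : ∀ F' ∈ Es', ∃ F ∈ E :: Es,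
            (F = E ∨ F = Hst ∨ Disjoint Z F ∨
              ∃ hF : IsClosed F,
                (∀ g ∈ Z ∩ F, stalkIdeal (vanishingIdeal (⟨Z, hZ⟩ : Closeds G)) g ⊔ stalkIdeal (vanishingIdeal (⟨F, hF⟩ : Closeds G)) g =
                    maximalIdeal (G.presheaf.stalk g)) ∧
                  ∀ g ∈ Z ∩ F, stalkIdeal (vanishingIdeal (⟨Z, hZ⟩ : Closeds G)) g ≠ maximalIdeal (G.presheaf.stalk g)) ∧
            F' = closure (υ₂ ⁻¹' (F \ Z)) := fun F' hF' => by
          obtain ⟨F, hF', h1, h2⟩ := hEs' F' hF'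
          refine ⟨F, hF', ?_, h2⟩
          rcases h1 with h | h | h
          · exact Or.inr (Or.inl h)
          · exact Or.inl (h.trans hWE)
          · exact Or.inr (Or.inr h)
        exact (fun h => ⟨h, hcar⟩) (hPairB G G' γ T E Es K E K hEcl' Z hZ Hst hH υ₂ K' (υ₂ ⁻¹' Z) Es' hI (Or.inl ⟨rfl, rfl⟩) hHmem hpair' hZT
          hZne hfull hZreg hZdim hυ₂ (hKmenu (Or.inr hWE)) (Or.inl rfl) hEs'B)
      · -- case C: neither is the running surface: host `Hst ∈ Es` (`KH := ∅`), `E` a plain candidate; the shadow only under `Disjoint`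
        have hHmemEs : Hst ∈ Es := (List.mem_cons.mp hHmem).resolve_left hHE
        have hTHst : ¬ T ⊆ Hst := (hI.1.2.2.2.2.2.2.2.1 Hst hHmemEs).2
        have hEs'C : ∀ F' ∈ Es', ∃ F ∈ E :: Es,
            (F = Hst ∨ F = W ∨ Disjoint Z F ∨
              ∃ hF : IsClosed F,
                (∀ g ∈ Z ∩ F, stalkIdeal (vanishingIdeal (⟨Z, hZ⟩ : Closeds G)) g ⊔ stalkIdeal (vanishingIdeal (⟨F, hF⟩ : Closeds G)) g =
                    maximalIdeal (G.presheaf.stalk g)) ∧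
                  ∀ g ∈ Z ∩ F, stalkIdeal (vanishingIdeal (⟨Z, hZ⟩ : Closeds G)) g ≠ maximalIdeal (G.presheaf.stalk g)) ∧
            F' = closure (υ₂ ⁻¹' (F \ Z)) := fun F' hF' => by
          obtain ⟨F, hF', hok⟩ := hEs' F' hF'
          exact ⟨F, hF', hok⟩
        obtain ⟨hB₀, -, -, -⟩ := hPairB G G' γ T E Es K Hst ∅ hH Z hZ W hW υ₂ ∅ (υ₂ ⁻¹' Z) Es' hI (Or.inr ⟨hHmemEs, rfl⟩) hWmem hpair hZT
          hZne hfull hZreg hZdim hυ₂ (Or.inl rfl) (Or.inl rfl) hEs'C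
        have hG'int : IsIntegral G' := hB₀.2.2.1
        haveI := hG'int
        rcases hK' with rfl | ⟨h, rfl⟩
        · exact ⟨⟨hB₀, isClosed_empty, Set.empty_subset _, Set.empty_ne_univ⟩, hcar⟩
        · have hZK : Disjoint Z (closure K) := by
            rcases h with ⟨hor, -⟩ | h
            · exact absurd hor (not_or.mpr ⟨hHE, hWE⟩)
            · exact h
          obtain ⟨-, hKcl, -, hKne⟩ := hI
          have hTZ : ¬ T ⊆ Z := fun h => hTHst (h.trans hZH)
          have hsub : closure (υ₂ ⁻¹' (K \ Z)) ⊆ υ₂ ⁻¹' closure K :=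
            closure_minimal (fun z hz => subset_closure hz.1) (isClosed_closure.preimage υ₂.continuous)
          have hEK : Disjoint (υ₂ ⁻¹' Z) (closure (closure (υ₂ ⁻¹' (K \ Z)))) := by
            rw [closure_closure]
            refine Set.disjoint_left.mpr fun z hzZ hzK => ?_
            exact (Set.disjoint_left.mp hZK) hzZ (hsub hzK)
          refine ⟨⟨Tower.invB_shadow_of_disjoint O k θ P q Y Ch _ F₉ Z₉ hZ₉ F₁₀ υ' G' (υ₂ ≫ γ) _ _ Es' _ hB₀ hEK, isClosed_closure, ?_, ?_⟩,
            hcar⟩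
          · refine closure_minimal (fun z hz => subset_closure ⟨subset_closure hz, fun hzZ => ?_⟩) isClosed_closure
            exact (Set.disjoint_left.mp hEK) hzZ (subset_closure (subset_closure hz))
          · exact closure_preimage_ne_univ υ₂ _ hυ₂ K Z hKcl hKne hZ (fun h => hTZ (h ▸ Set.subset_univ _)) hZsupp.le _
              (Set.preimage_mono fun z hz => hz.1)

/-- **The same round closure in the shape of the tower assembly V10′/V10″** (`INV₁` with the extra conjunct `IsLocallyNoetherian F₉`). [OURS · pure repackaging] -/
theorem Tower.towerRoundBDoublePrime_invB_of_fact' (hFact : EmbeddedCurveLift O k θ P q) :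
    ∀ {F₉ : Scheme.{0}} (Z₉ : Set F₉) (hZ₉ : IsClosed Z₉) {F₁₀ : Scheme.{0}} (υ' : F₁₀ ⟶ F₉),
      TowerRoundBDoublePrime F₉ F₁₀ υ' Z₉ hZ₉ (fun G γ T E Es K =>
        (Tower.InvB O k θ P q Y Ch (fun _ _ _ _ _ _ _ _ _ σ _ 𝓔 => Flat (𝓔.subschemeι ≫ σ ≫ q)) F₉ Z₉ hZ₉ F₁₀ υ' G γ T E Es K ∧
          IsClosed K ∧ K ⊆ closure (K \ E) ∧ K ≠ Set.univ) ∧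
        (∀ z : ↥(redSub F₉ Z₉ hZ₉), IsClosed ({z} : Set ↥(redSub F₉ Z₉ hZ₉)) →
          ringKrullDim ((redSub F₉ Z₉ hZ₉).presheaf.stalk z) = ((1 : ℕ) : WithBot ℕ∞)) ∧ IsLocallyNoetherian F₉) := by
  intro F₉ Z₉ hZ₉ F₁₀ υ' G G' γ T E Es K hE Z hZ Hst W υ₂ K' E' Es' hinv hZT hZne hfull hadm hυ₂ hEs'
  obtain ⟨hI, hcar, hF₉noeth⟩ := hinv
  exact ⟨Tower.towerRoundBDoublePrime_invB_of_fact O k θ hθ P q Y hYsp hYirr hYcl hPnoeth hPreg Ch hChStep hChSplit hFact Z₉ hZ₉ υ' hF₉noeth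
    G G' γ T E Es K hE Z hZ Hst W υ₂ K' E' Es' ⟨hI, hcar⟩ hZT hZne hfull hadm hυ₂ hEs' |>.1,
    Tower.towerRoundBDoublePrime_invB_of_fact O k θ hθ P q Y hYsp hYirr hYcl hPnoeth hPreg Ch hChStep hChSplit hFact Z₉ hZ₉ υ' hF₉noeth
    G G' γ T E Es K hE Z hZ Hst W υ₂ K' E' Es' ⟨hI, hcar⟩ hZT hZne hfull hadm hυ₂ hEs' |>.2, hF₉noeth⟩

end Closure

end Summit.ResolutionOfSingularities.ResolutionOfSingularities.Cruxes.EquisingularLiftNat.Sections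

end
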